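import Summits.CriticalPhenomena.PercolationContinuityZ3.Theorems.SahiBoxTP2FourFunctions
import Summits.CriticalPhenomena.PercolationContinuityZ3.Theorems.SahiBoxTP2Tilt
import Summits.CriticalPhenomena.PercolationContinuityZ3.Theorems.SahiLiebSahiContinuumDensityPrelim
import Literature.Probability.Percolation.PositiveAssociationLimits

/-!
# Holley's theorem on the unit cube for an arbitrary (singular) box-TP₂ a priori measure: continuous weights with
# the cross condition give stochastically ordered tilts; continuous-spin Gibbs measures ordered à la Holley

Support file of the Sahi cell (`prim-sahi`, typer seat, generation 15; `--supports stmt-CriticalPhenomena-4575`).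
Theorems only (no definitions, no named facts, no sorries).  Instance of the density-free four functions theorem
`fourFunctions_of_fiber` (`SahiBoxTP2FourFunctions.lean`) on `Q_d = [0,1]^d` with the discretisation scheme
`x ↦ lower corner of the level-m grid cell of x` (`cellLoCorner m (cubeCell m x)`, generation 11/14 API): a
measurable lattice homomorphism with finite range whose fibres are the grid cells, TP₂ under any box-TP₂ law by
generation 14's `IsBoxTP2.cubeCellWeight_latticeCondition`; `φ_m x ≤ x`, `φ_m x → x`, so continuous functions and
indicators of CLOSED DOWN-SETS are regular along the scheme.

* `IsBoxTP2.holley_lowerSet_cube` — for a finite box-TP₂ measure `μ` on `Q_d` (singular allowed), continuous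
  `g₁, g₂ ≥ 0` with the cross condition `g₁(x)g₂(y) ≤ g₁(x ∧ y)g₂(x ∨ y)` and a closed down-set `D`:
  `(∫ g₁)(∫_D g₂) ≤ (∫_D g₁)(∫ g₂)`.
* `IsBoxTP2.holley_upperSet_cube` — hence for EVERY measurable up-set `U`: `(∫_U g₁)(∫ g₂) ≤ (∫ g₁)(∫_U g₂)`
  (inner regularity of the complementary down-set by lower closures of compact sets, which are closed down-sets).
* `IsBoxTP2.holley_integral_cube` — **HOLLEY'S INEQUALITY ON `Q_d`, density-free**: `(∫ g₁h)(∫ g₂) ≤ (∫ g₁)(∫ g₂h)`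
  for every bounded measurable increasing `h` (layer cake, `integral_mul_le_mul_integral_of_upperSets`).
* `IsBoxTP2.gibbs_holley_cube` — **continuous-spin Gibbs measures on `[0,1]^d` with an arbitrary box-TP₂ a priori
  measure `μ` and continuous energies `H₁, H₂` satisfying Holley's condition
  `H₁(x ∧ y) + H₂(x ∨ y) ≤ H₁(x) + H₂(y)` are stochastically ordered**:
  `(∫ e^{−H₁}f dμ)(∫ e^{−H₂} dμ) ≤ (∫ e^{−H₁} dμ)(∫ e^{−H₂}f dμ)` for all bounded measurable increasing `f`
  (product reference measure with densities: Preston 1974 / Holley 1974; singular base: the cell's).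

No sorries, no new axioms.
-/

noncomputable section

namespace Summit.CriticalPhenomena.PercolationContinuityZ3.Theorems.SahiBoxTP2

open MeasureTheory Set Filter Topology Function
open Literature.Combinatorics.Sahi2008 Literature.Combinatorics.Sahi2008.LebesgueSquare
open Literature.Combinatorics.Sahi2008.LebesgueCube SahiCubeDensity
open scoped ENNReal unitInterval

section Cube

variable {d : ℕ}

/-! ### The lower-corner scheme -/

/-- The lower-corner scheme commutes with `∧`. [folklore] -/
theorem loCornerCell_inf (m : ℕ) (x y : Fin d → I) :
    cellLoCorner m (cubeCell m (x ⊓ y)) = cellLoCorner m (cubeCell m x) ⊓ cellLoCorner m (cubeCell m y) := by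
  rw [cubeCell_inf, cellLoCorner_inf]

/-- The lower-corner scheme commutes with `∨`. [folklore] -/
theorem loCornerCell_sup (m : ℕ) (x y : Fin d → I) :
    cellLoCorner m (cubeCell m (x ⊔ y)) = cellLoCorner m (cubeCell m x) ⊔ cellLoCorner m (cubeCell m y) := by
  rw [cubeCell_sup, cellLoCorner_sup]

/-- The lower-corner scheme is measurable. [folklore] -/
theorem measurable_loCornerCell (m : ℕ) : Measurable fun x : Fin d → I => cellLoCorner m (cubeCell m x) :=
  (measurable_of_countable (cellLoCorner (d := d) m)).comp (measurable_cubeCell m)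

/-- The lower-corner scheme has finite range. [folklore] -/
theorem finite_range_loCornerCell (m : ℕ) : (range fun x : Fin d → I => cellLoCorner m (cubeCell m x)).Finite :=
  (Set.finite_range (cellLoCorner (d := d) m)).subset
    (range_comp_subset_range (cubeCell (d := d) m) (cellLoCorner m))

/-- The lower corner lies below the point. [folklore] -/
theorem loCornerCell_le (m : ℕ) (x : Fin d → I) : cellLoCorner m (cubeCell m x) ≤ x := loCube_cubeCell_le x

/-- The fibre of the scheme over a grid point is its cell. [folklore] -/
theorem preimage_loCornerCell_singleton_of_eq (m : ℕ) {a : Fin d → I} (ha : cellLoCorner m (cubeCell m a) = a) :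
    (fun x : Fin d → I => cellLoCorner m (cubeCell m x)) ⁻¹' {a} = cubeCell m ⁻¹' {cubeCell m a} := by
  ext x
  simp only [mem_preimage, mem_singleton_iff]
  constructor
  · intro h
    rw [← h, cubeCell_cellLoCorner]
  · intro h
    rw [h, ha]

/-- The fibre of the scheme over a non-grid point is empty. [folklore] -/
theorem preimage_loCornerCell_singleton_of_ne (m : ℕ) {a : Fin d → I} (ha : cellLoCorner m (cubeCell m a) ≠ a) :
    (fun x : Fin d → I => cellLoCorner m (cubeCell m x)) ⁻¹' {a} = ∅ := by
  ext x
  simp only [mem_preimage, mem_singleton_iff, mem_empty_iff_false, iff_false]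
  intro h
  apply ha
  rw [← h, cubeCell_cellLoCorner]

/-- **The fibres of the lower-corner scheme (the grid cells) are TP₂ under a box-TP₂ law.** [this work] -/
theorem IsBoxTP2.fiber_loCornerCell_mul_le (μ : Measure (Fin d → I)) [IsFiniteMeasure μ] (hμ : IsBoxTP2 μ) (m : ℕ)
    (a b : Fin d → I) :
    μ ((fun x : Fin d → I => cellLoCorner m (cubeCell m x)) ⁻¹' {a}) *
        μ ((fun x : Fin d → I => cellLoCorner m (cubeCell m x)) ⁻¹' {b}) ≤
      μ ((fun x : Fin d → I => cellLoCorner m (cubeCell m x)) ⁻¹' {a ⊓ b}) *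
        μ ((fun x : Fin d → I => cellLoCorner m (cubeCell m x)) ⁻¹' {a ⊔ b}) := by
  by_cases ha : cellLoCorner m (cubeCell m a) = a
  · by_cases hb : cellLoCorner m (cubeCell m b) = b
    · have hab : cellLoCorner m (cubeCell m (a ⊓ b)) = a ⊓ b := by rw [loCornerCell_inf, ha, hb]
      have hab' : cellLoCorner m (cubeCell m (a ⊔ b)) = a ⊔ b := by rw [loCornerCell_sup, ha, hb]
      rw [preimage_loCornerCell_singleton_of_eq m ha, preimage_loCornerCell_singleton_of_eq m hb,
        preimage_loCornerCell_singleton_of_eq m hab, preimage_loCornerCell_singleton_of_eq m hab', cubeCell_inf,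
        cubeCell_sup]
      have key := hμ.cubeCellWeight_latticeCondition μ m (cubeCell m a) (cubeCell m b)
      simp only [cubeCellWeight, measureReal_def, ← ENNReal.toReal_mul] at key
      exact (ENNReal.toReal_le_toReal (ENNReal.mul_ne_top (measure_ne_top _ _) (measure_ne_top _ _))
        (ENNReal.mul_ne_top (measure_ne_top _ _) (measure_ne_top _ _))).1 key
    · rw [preimage_loCornerCell_singleton_of_ne m hb, measure_empty, mul_zero]
      exact zero_le
  · rw [preimage_loCornerCell_singleton_of_ne m ha, measure_empty, zero_mul]
    exact zero_le

/-- Continuous functions are regular along the scheme. [folklore] -/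
theorem tendsto_comp_loCornerCell {f : (Fin d → I) → ℝ} (hf : Continuous f) (x : Fin d → I) :
    Tendsto (fun m : ℕ => f (cellLoCorner m (cubeCell m x))) atTop (𝓝 (f x)) :=
  (hf.tendsto x).comp (tendsto_cellLoCorner_cubeCell x)

/-- Indicators of closed down-sets are regular along the scheme (`φ_m x ≤ x`, `φ_m x → x`). [folklore] -/
theorem tendsto_indicator_comp_loCornerCell {D : Set (Fin d → I)} (hDc : IsClosed D) (hD : IsLowerSet D)
    (x : Fin d → I) :
    Tendsto (fun m : ℕ => D.indicator (1 : (Fin d → I) → ℝ) (cellLoCorner m (cubeCell m x))) atTop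
      (𝓝 (D.indicator 1 x)) := by
  by_cases hx : x ∈ D
  · have : ∀ m : ℕ, D.indicator (1 : (Fin d → I) → ℝ) (cellLoCorner m (cubeCell m x)) = D.indicator 1 x :=
      fun m => by rw [indicator_of_mem hx, indicator_of_mem (hD (loCornerCell_le m x) hx), Pi.one_apply, Pi.one_apply]
    simp only [this]
    exact tendsto_const_nhds
  · have hev : ∀ᶠ m : ℕ in atTop, cellLoCorner m (cubeCell m x) ∈ Dᶜ :=
      (tendsto_cellLoCorner_cubeCell x) (hDc.isOpen_compl.mem_nhds hx)
    refine (tendsto_const_nhds (x := (0 : ℝ))).congr' (hev.mono fun m hm => ?_) |>.trans ?_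
    · rw [indicator_of_notMem hm]
    · rw [indicator_of_notMem hx]

/-! ### Holley's inequality with continuous weights on `Q_d` -/

/-- **Holley on `Q_d`, closed down-sets**: `μ` finite box-TP₂ (singular allowed), `g₁, g₂ ≥ 0` continuous with the
cross condition `g₁(x)g₂(y) ≤ g₁(x ∧ y)g₂(x ∨ y)`, `D` a closed down-set: `(∫ g₁)(∫_D g₂) ≤ (∫_D g₁)(∫ g₂)`.
[this work] -/
theorem IsBoxTP2.holley_lowerSet_cube (μ : Measure (Fin d → I)) [IsFiniteMeasure μ] (hμ : IsBoxTP2 μ)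
    {g₁ g₂ : (Fin d → I) → ℝ} (hg₁c : Continuous g₁) (hg₂c : Continuous g₂) (hg₁0 : ∀ x, 0 ≤ g₁ x)
    (hg₂0 : ∀ x, 0 ≤ g₂ x) {C : ℝ} (hg₁C : ∀ x, g₁ x ≤ C) (hg₂C : ∀ x, g₂ x ≤ C)
    (hcross : ∀ x y, g₁ x * g₂ y ≤ g₁ (x ⊓ y) * g₂ (x ⊔ y)) {D : Set (Fin d → I)} (hDc : IsClosed D)
    (hD : IsLowerSet D) :
    (∫ x, g₁ x ∂μ) * (∫ x in D, g₂ x ∂μ) ≤ (∫ x in D, g₁ x ∂μ) * (∫ x, g₂ x ∂μ) := by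
  classical
  have hDm : MeasurableSet D := hDc.measurableSet
  have hind : ∀ (g : (Fin d → I) → ℝ) x, D.indicator g x = D.indicator (1 : (Fin d → I) → ℝ) x * g x :=
    fun g x => by
      by_cases hx : x ∈ D
      · simp [indicator_of_mem hx]
      · simp [indicator_of_notMem hx]
  have key := fourFunctions_of_fiber μ (fun m x => cellLoCorner m (cubeCell m x)) measurable_loCornerCell
    loCornerCell_inf loCornerCell_sup finite_range_loCornerCell (fun m => hμ.fiber_loCornerCell_mul_le μ m)
    ![g₁, D.indicator g₂, D.indicator g₁, g₂]
    (fun j x => by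
      fin_cases j
      · exact hg₁0 x
      · exact indicator_nonneg (fun y _ => hg₂0 y) x
      · exact indicator_nonneg (fun y _ => hg₁0 y) x
      · exact hg₂0 x)
    (fun j => by
      fin_cases j
      · exact hg₁c.measurable
      · exact hg₂c.measurable.indicator hDm
      · exact hg₁c.measurable.indicator hDm
      · exact hg₂c.measurable)
    (C := C) (fun j x => by
      fin_cases j
      · exact hg₁C x
      · exact (Set.indicator_le_self' (fun y _ => hg₂0 y) x).trans (hg₂C x)
      · exact (Set.indicator_le_self' (fun y _ => hg₁0 y) x).trans (hg₁C x)
      · exact hg₂C x)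
    (fun j => Eventually.of_forall fun x => by
      fin_cases j
      · exact tendsto_comp_loCornerCell hg₁c x
      · show Tendsto (fun m : ℕ => D.indicator g₂ (cellLoCorner m (cubeCell m x))) atTop (𝓝 (D.indicator g₂ x))
        simp only [hind g₂]
        exact (tendsto_indicator_comp_loCornerCell hDc hD x).mul (tendsto_comp_loCornerCell hg₂c x)
      · show Tendsto (fun m : ℕ => D.indicator g₁ (cellLoCorner m (cubeCell m x))) atTop (𝓝 (D.indicator g₁ x))
        simp only [hind g₁]
        exact (tendsto_indicator_comp_loCornerCell hDc hD x).mul (tendsto_comp_loCornerCell hg₁c x)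
      · exact tendsto_comp_loCornerCell hg₂c x)
    (fun x y => by
      show g₁ x * D.indicator g₂ y ≤ D.indicator g₁ (x ⊓ y) * g₂ (x ⊔ y)
      by_cases hy : y ∈ D
      · rw [indicator_of_mem hy, indicator_of_mem (hD inf_le_right hy)]
        exact hcross x y
      · rw [indicator_of_notMem hy, mul_zero]
        exact mul_nonneg (indicator_nonneg (fun z _ => hg₁0 z) _) (hg₂0 _))
  change (∫ x, g₁ x ∂μ) * (∫ x, D.indicator g₂ x ∂μ) ≤ (∫ x, D.indicator g₁ x ∂μ) * (∫ x, g₂ x ∂μ) at key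
  rwa [integral_indicator hDm, integral_indicator hDm] at key

/-- **Holley on `Q_d`, all measurable up-sets**: with `μ, g₁, g₂` as above and `U` ANY measurable up-set,
`(∫_U g₁)(∫ g₂) ≤ (∫ g₁)(∫_U g₂)` — the complementary down-set is exhausted, up to a null set, by the closed
down-sets `↓(K₁ ∪ … ∪ K_j)` generated by compact inner approximations. [this work] -/
theorem IsBoxTP2.holley_upperSet_cube (μ : Measure (Fin d → I)) [IsFiniteMeasure μ] (hμ : IsBoxTP2 μ)
    {g₁ g₂ : (Fin d → I) → ℝ} (hg₁c : Continuous g₁) (hg₂c : Continuous g₂) (hg₁0 : ∀ x, 0 ≤ g₁ x)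
    (hg₂0 : ∀ x, 0 ≤ g₂ x) {C : ℝ} (hg₁C : ∀ x, g₁ x ≤ C) (hg₂C : ∀ x, g₂ x ≤ C)
    (hcross : ∀ x y, g₁ x * g₂ y ≤ g₁ (x ⊓ y) * g₂ (x ⊔ y)) {U : Set (Fin d → I)} (hU : IsUpperSet U)
    (hUm : MeasurableSet U) :
    (∫ x in U, g₁ x ∂μ) * (∫ x, g₂ x ∂μ) ≤ (∫ x, g₁ x ∂μ) * (∫ x in U, g₂ x ∂μ) := by
  set D := Uᶜ with hDdef
  have hDm : MeasurableSet D := hUm.compl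
  have hD : IsLowerSet D := hU.compl
  have hgi : ∀ {g : (Fin d → I) → ℝ}, Continuous g → (∀ x, 0 ≤ g x) → (∀ x, g x ≤ C) → Integrable g μ :=
    fun {g} hgc hg0' hgC' => Integrable.of_bound hgc.measurable.aestronglyMeasurable C
      (Eventually.of_forall fun x => by rw [Real.norm_eq_abs, abs_of_nonneg (hg0' x)]; exact hgC' x)
  -- compact inner approximations of `D` and the closed down-sets they generate
  have happ : ∀ j : ℕ, ∃ K, K ⊆ D ∧ IsCompact K ∧ μ (D \ K) < ((j : ℝ≥0∞) + 1)⁻¹ := fun j =>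
    hDm.exists_isCompact_sdiff_lt (measure_ne_top μ _)
      (ENNReal.inv_ne_zero.2 (ENNReal.add_ne_top.2 ⟨ENNReal.natCast_ne_top j, ENNReal.one_ne_top⟩))
  choose K hKD hKc hKμ using happ
  set E : ℕ → Set (Fin d → I) := fun j => (lowerClosure (accumulate K j) : Set (Fin d → I)) with hEdef
  have hEc : ∀ j, IsClosed (E j) := fun j =>
    Literature.Probability.Percolation.isClosed_lowerClosure_of_isCompact (isCompact_accumulate hKc j)
  have hEl : ∀ j, IsLowerSet (E j) := fun j => (lowerClosure _).lower
  have hED : ∀ j, E j ⊆ D := fun j x hx => by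
    obtain ⟨a, ha, hxa⟩ := mem_lowerClosure.1 hx
    obtain ⟨i, -, hi⟩ := mem_accumulate.1 ha
    exact hD hxa (hKD i hi)
  have hEmono : Monotone E := fun i j hij x hx => by
    obtain ⟨a, ha, hxa⟩ := mem_lowerClosure.1 hx
    exact mem_lowerClosure.2 ⟨a, monotone_accumulate hij ha, hxa⟩
  have hKE : ∀ j, K j ⊆ E j := fun j => (subset_accumulate (s := K)).trans subset_lowerClosure
  -- the union exhausts `D` up to a null set
  have hnull : μ (D \ ⋃ j, E j) = 0 := by
    by_contra h0
    obtain ⟨N, hN⟩ := ENNReal.exists_inv_nat_lt h0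
    have h1 : μ (D \ ⋃ j, E j) ≤ μ (D \ K N) :=
      measure_mono (sdiff_subset_sdiff_right ((hKE N).trans (subset_iUnion E N)))
    have h2 : ((N : ℝ≥0∞) + 1)⁻¹ ≤ (N : ℝ≥0∞)⁻¹ := ENNReal.inv_le_inv.2 le_self_add
    exact lt_irrefl _ (((hN.trans_le h1).trans (hKμ N)).trans_le h2)
  have hae : (⋃ j, E j : Set (Fin d → I)) =ᵐ[μ] D := by
    refine (ae_eq_set).2 ⟨?_, hnull⟩
    rw [sdiff_eq_empty.2 (iUnion_subset hED), measure_empty]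
  -- Holley on each `E j`, then the limit
  have hj : ∀ j, (∫ x, g₁ x ∂μ) * (∫ x in E j, g₂ x ∂μ) ≤ (∫ x in D, g₁ x ∂μ) * (∫ x, g₂ x ∂μ) := fun j =>
    (hμ.holley_lowerSet_cube μ hg₁c hg₂c hg₁0 hg₂0 hg₁C hg₂C hcross (hEc j) (hEl j)).trans
      (mul_le_mul_of_nonneg_right (setIntegral_mono_set (hgi hg₁c hg₁0 hg₁C).integrableOn
        (Eventually.of_forall hg₁0) (Eventually.of_forall (hED j))) (integral_nonneg hg₂0))
  have hlim : Tendsto (fun j => ∫ x in E j, g₂ x ∂μ) atTop (𝓝 (∫ x in D, g₂ x ∂μ)) := by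
    rw [← setIntegral_congr_set hae]
    exact tendsto_setIntegral_of_monotone (fun j => (hEc j).measurableSet) hEmono
      (hgi hg₂c hg₂0 hg₂C).integrableOn
  have hDineq : (∫ x, g₁ x ∂μ) * (∫ x in D, g₂ x ∂μ) ≤ (∫ x in D, g₁ x ∂μ) * (∫ x, g₂ x ∂μ) :=
    le_of_tendsto' (tendsto_const_nhds.mul hlim) hj
  -- pass to the complement `U = Dᶜ`
  have e1 := integral_add_compl hUm (hgi hg₁c hg₁0 hg₁C)
  have e2 := integral_add_compl hUm (hgi hg₂c hg₂0 hg₂C)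
  rw [← hDdef] at e1 e2
  have h1 : ∫ x in U, g₁ x ∂μ = (∫ x, g₁ x ∂μ) - ∫ x in D, g₁ x ∂μ := by linarith [e1]
  have h2 : ∫ x in U, g₂ x ∂μ = (∫ x, g₂ x ∂μ) - ∫ x in D, g₂ x ∂μ := by linarith [e2]
  rw [h1, h2]
  linarith [hDineq,
    show ((∫ x, g₁ x ∂μ) - ∫ x in D, g₁ x ∂μ) * (∫ x, g₂ x ∂μ) =
      (∫ x, g₁ x ∂μ) * (∫ x, g₂ x ∂μ) - (∫ x in D, g₁ x ∂μ) * (∫ x, g₂ x ∂μ) by ring,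
    show (∫ x, g₁ x ∂μ) * ((∫ x, g₂ x ∂μ) - ∫ x in D, g₂ x ∂μ) =
      (∫ x, g₁ x ∂μ) * (∫ x, g₂ x ∂μ) - (∫ x, g₁ x ∂μ) * (∫ x in D, g₂ x ∂μ) by ring]

/-- **HOLLEY'S INEQUALITY ON `Q_d`, DENSITY-FREE**: `μ` finite box-TP₂ on `[0,1]^d` (singular allowed), `g₁, g₂ ≥ 0`
continuous with the cross condition `g₁(x)g₂(y) ≤ g₁(x ∧ y)g₂(x ∨ y)`: for every bounded measurable increasing
`h`, `(∫ g₁h dμ)(∫ g₂ dμ) ≤ (∫ g₁ dμ)(∫ g₂h dμ)` — the normalised tilts satisfy `g₁μ/Z₁ ≤_st g₂μ/Z₂`.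
[this work] -/
theorem IsBoxTP2.holley_integral_cube (μ : Measure (Fin d → I)) [IsFiniteMeasure μ] (hμ : IsBoxTP2 μ)
    {g₁ g₂ : (Fin d → I) → ℝ} (hg₁c : Continuous g₁) (hg₂c : Continuous g₂) (hg₁0 : ∀ x, 0 ≤ g₁ x)
    (hg₂0 : ∀ x, 0 ≤ g₂ x) {C : ℝ} (hg₁C : ∀ x, g₁ x ≤ C) (hg₂C : ∀ x, g₂ x ≤ C)
    (hcross : ∀ x y, g₁ x * g₂ y ≤ g₁ (x ⊓ y) * g₂ (x ⊔ y)) {h : (Fin d → I) → ℝ} (hhm : Measurable h)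
    (hh : Monotone h) {B : ℝ} (hhB : ∀ x, |h x| ≤ B) :
    (∫ x, g₁ x * h x ∂μ) * (∫ x, g₂ x ∂μ) ≤ (∫ x, g₁ x ∂μ) * (∫ x, g₂ x * h x ∂μ) := by
  -- the tilted measures
  have hdens : ∀ {g : (Fin d → I) → ℝ}, Continuous g → Measurable fun x => ENNReal.ofReal (g x) :=
    fun hgc => ENNReal.measurable_ofReal.comp hgc.measurable
  set ν₁ := μ.withDensity fun x => ENNReal.ofReal (g₁ x) with hν₁
  set ν₂ := μ.withDensity fun x => ENNReal.ofReal (g₂ x) with hν₂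
  have hfin : ∀ {g : (Fin d → I) → ℝ}, (∀ x, g x ≤ C) →
      IsFiniteMeasure (μ.withDensity fun x => ENNReal.ofReal (g x)) := fun {g} hgC' => by
    refine isFiniteMeasure_withDensity (ne_top_of_le_ne_top ?_ (lintegral_mono fun x => ENNReal.ofReal_le_ofReal (hgC' x)))
    rw [lintegral_const]
    exact ENNReal.mul_ne_top ENNReal.ofReal_ne_top (measure_ne_top _ _)
  haveI := hfin hg₁C
  haveI := hfin hg₂C
  have hgi : ∀ {g : (Fin d → I) → ℝ}, Continuous g → (∀ x, 0 ≤ g x) → (∀ x, g x ≤ C) → ∀ S,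
      Integrable g (μ.restrict S) := fun {g} hgc hg0' hgC' S =>
    Integrable.of_bound hgc.measurable.aestronglyMeasurable C
      (Eventually.of_forall fun x => by rw [Real.norm_eq_abs, abs_of_nonneg (hg0' x)]; exact hgC' x)
  have happ : ∀ {g : (Fin d → I) → ℝ} (hgc : Continuous g) (hg0' : ∀ x, 0 ≤ g x) (hgC' : ∀ x, g x ≤ C) (S : Set _),
      MeasurableSet S → (μ.withDensity fun x => ENNReal.ofReal (g x)) S = ENNReal.ofReal (∫ x in S, g x ∂μ) :=
    fun {g} hgc hg0' hgC' S hS => by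
      rw [withDensity_apply _ hS, ofReal_integral_eq_lintegral_ofReal (hgi hgc hg0' hgC' S) (Eventually.of_forall hg0')]
  have huniv : ∀ {g : (Fin d → I) → ℝ} (hgc : Continuous g) (hg0' : ∀ x, 0 ≤ g x) (hgC' : ∀ x, g x ≤ C),
      (μ.withDensity fun x => ENNReal.ofReal (g x)) univ = ENNReal.ofReal (∫ x, g x ∂μ) :=
    fun {g} hgc hg0' hgC' => by rw [happ hgc hg0' hgC' univ MeasurableSet.univ, Measure.restrict_univ]
  have key := integral_mul_le_mul_integral_of_upperSets ν₁ ν₂ (fun U hU hUm => ?_) hh hhm hhB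
  · -- translate back to `μ`
    rw [hν₁, hν₂, integral_withDensity_eq_integral_toReal_smul (hdens hg₁c) (Eventually.of_forall fun _ =>
        ENNReal.ofReal_lt_top), integral_withDensity_eq_integral_toReal_smul (hdens hg₂c)
        (Eventually.of_forall fun _ => ENNReal.ofReal_lt_top), measureReal_def, measureReal_def,
      huniv hg₁c hg₁0 hg₁C, huniv hg₂c hg₂0 hg₂C, ENNReal.toReal_ofReal (integral_nonneg hg₁0),
      ENNReal.toReal_ofReal (integral_nonneg hg₂0)] at key
    simp only [ENNReal.toReal_ofReal (hg₁0 _), ENNReal.toReal_ofReal (hg₂0 _), smul_eq_mul] at key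
    linarith [key]
  · rw [happ hg₁c hg₁0 hg₁C U hUm, happ hg₂c hg₂0 hg₂C U hUm, huniv hg₁c hg₁0 hg₁C, huniv hg₂c hg₂0 hg₂C,
      ← ENNReal.ofReal_mul (integral_nonneg hg₁0), ← ENNReal.ofReal_mul (integral_nonneg hg₁0)]
    exact ENNReal.ofReal_le_ofReal (hμ.holley_upperSet_cube μ hg₁c hg₂c hg₁0 hg₂0 hg₁C hg₂C hcross hU hUm)

/-- **CONTINUOUS-SPIN GIBBS MEASURES ON `[0,1]^d` WITH A SINGULAR A PRIORI MEASURE ARE ORDERED À LA HOLLEY**: for a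
finite box-TP₂ measure `μ` on `Q_d` and continuous energies `H₁, H₂` with
`H₁(x ∧ y) + H₂(x ∨ y) ≤ H₁(x) + H₂(y)`, the Gibbs measures `e^{−H₁}μ/Z₁ ≤_st e^{−H₂}μ/Z₂`:
`(∫ e^{−H₁}f dμ)(∫ e^{−H₂} dμ) ≤ (∫ e^{−H₁} dμ)(∫ e^{−H₂}f dμ)` for every bounded measurable increasing `f`.
[this work] -/
theorem IsBoxTP2.gibbs_holley_cube (μ : Measure (Fin d → I)) [IsFiniteMeasure μ] (hμ : IsBoxTP2 μ)
    {H₁ H₂ : (Fin d → I) → ℝ} (hH₁ : Continuous H₁) (hH₂ : Continuous H₂)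
    (hHolley : ∀ x y, H₁ (x ⊓ y) + H₂ (x ⊔ y) ≤ H₁ x + H₂ y) {f : (Fin d → I) → ℝ} (hfm : Measurable f)
    (hf : Monotone f) {B : ℝ} (hfB : ∀ x, |f x| ≤ B) :
    (∫ x, Real.exp (-H₁ x) * f x ∂μ) * (∫ x, Real.exp (-H₂ x) ∂μ) ≤
      (∫ x, Real.exp (-H₁ x) ∂μ) * (∫ x, Real.exp (-H₂ x) * f x ∂μ) := by
  -- continuous energies on the compact cube are bounded below
  obtain ⟨M₁, hM₁⟩ : ∃ M, ∀ x, -H₁ x ≤ M := by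
    obtain ⟨x₀, hx₀⟩ := hH₁.neg.exists_forall_ge' (x₀ := fun _ => 0) (by
      simp only [cocompact_eq_bot, eventually_bot])
    exact ⟨-H₁ x₀, hx₀⟩
  obtain ⟨M₂, hM₂⟩ : ∃ M, ∀ x, -H₂ x ≤ M := by
    obtain ⟨x₀, hx₀⟩ := hH₂.neg.exists_forall_ge' (x₀ := fun _ => 0) (by
      simp only [cocompact_eq_bot, eventually_bot])
    exact ⟨-H₂ x₀, hx₀⟩
  exact hμ.holley_integral_cube μ (g₁ := fun x => Real.exp (-H₁ x)) (g₂ := fun x => Real.exp (-H₂ x))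
    (by fun_prop) (by fun_prop) (fun x => (Real.exp_pos _).le)
    (fun x => (Real.exp_pos _).le) (C := Real.exp (max M₁ M₂))
    (fun x => Real.exp_le_exp.2 ((hM₁ x).trans (le_max_left _ _)))
    (fun x => Real.exp_le_exp.2 ((hM₂ x).trans (le_max_right _ _)))
    (fun x y => by
      rw [← Real.exp_add, ← Real.exp_add]
      exact Real.exp_le_exp.2 (by linarith [hHolley x y])) hfm hf hfB

end Cube

end Summit.CriticalPhenomena.PercolationContinuityZ3.Theorems.SahiBoxTP2
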